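import Summits.CriticalPhenomena.PercolationContinuityZ3.Theorems.PercNearOneGluingNoHeavyLowerTailFrontierAveraging
import Summits.CriticalPhenomena.PercolationContinuityZ3.Theorems.PercNearOneGluingNoHeavyLowerTailHullPortTransfer
import Summits.CriticalPhenomena.PercolationContinuityZ3.Theorems.PercNearOneGluingNoHeavyLowerTailCILCutObserverTools
import HarnessLib

/-!
# `NoHeavyLowerTail` (stmt-CriticalPhenomena-4575) — structural tools for the relay FRONTIER of an observer

Support file (prover `prim-lf-2`, lemma factory "deletion–contraction / pivotal edge", gen 2; `--supports stmt-CriticalPhenomena-4575`).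
No definitions, no named facts, no sorries.  Companion of `…FrontierAveraging` (the registered target `stub_frontierAveraging`).

For a configuration `ω`, relays `A`, an observer `o ∉ A` and a relay `r`, the FRONTIER EVENT "r is a frontier relay of o" is written inline as
`(openGraph (ω ∩ {e | ∀ v, v ∈ e → v ∉ A ∨ v = r})).Reachable o r`: `o` reaches `r` through open pairs all of whose endpoints are non-relays
or `r` itself, i.e. by an open path whose interior avoids `A`.  The three facts every proof of the frontier-averaged port inequality needs:

* `FrontierTools.reachable_of_frontier` — a frontier relay is joined to `o` (monotonicity of reachability in the configuration).
* `FrontierTools.filter_eq_of_frontier` — hence on that event `π(o) = π(r)`: the observer sees exactly the relays its frontier relay sees,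
  so `{1 ≤ N ≤ j} ∩ {r frontier} = {|π(r)| ≤ j} ∩ {r frontier}`.
* `FrontierTools.exists_frontier_of_reachable` — conversely, if `o` is joined to SOME relay then it has a frontier relay (the first relay on
  an open walk; induction on the walk).  Hence `{N ≥ 1} = {Γ* ≠ ∅}`.
-/

noncomputable section

namespace Summit.CriticalPhenomena.PercolationContinuityZ3.Theorems

open MeasureTheory Set Literature.Probability.LatticeModels Literature.Probability.Percolation
open scoped Classical BigOperators

variable {n : ℕ}

namespace FrontierTools

/-- **A frontier relay is joined to the observer**: reachability in the restricted configuration `ω ∩ E` implies reachability in `ω`.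
[folklore] -/
theorem reachable_of_frontier (A : Finset (Fin n)) {ω : BondConfig (Fin n)} {o r : Fin n}
    (h : (openGraph (ω ∩ {e | ∀ v, v ∈ e → v ∉ A ∨ v = r})).Reachable o r) :
    (openGraph ω).Reachable o r :=
  CutObserver.reachable_mono Set.inter_subset_left h

/-- **On the frontier event the observer and its frontier relay see the same relays**: `π(o) = π(r)` as filtered sets. [folklore] -/
theorem filter_eq_of_frontier (A : Finset (Fin n)) {ω : BondConfig (Fin n)} {o r : Fin n}
    (h : (openGraph (ω ∩ {e | ∀ v, v ∈ e → v ∉ A ∨ v = r})).Reachable o r) :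
    (A.filter fun x => ω ∈ openConn o x) = (A.filter fun x => ω ∈ openConn r x) :=
  HullPortTransfer.filter_eq_of_reachable A (reachable_of_frontier A h).symm

/-- Walk version of `exists_frontier_of_reachable`: an open walk from a non-relay `u` to a relay `a` passes a first relay `r`, and the
initial segment up to `r` uses only pairs whose endpoints are non-relays or `r`. [folklore] -/
theorem exists_frontier_of_walk (A : Finset (Fin n)) (ω : BondConfig (Fin n)) :
    ∀ {u a : Fin n} (_ : (openGraph ω).Walk u a), u ∉ A → a ∈ A →
      ∃ r ∈ A, (openGraph (ω ∩ {e | ∀ v, v ∈ e → v ∉ A ∨ v = r})).Reachable u r := by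
  intro u a p
  induction p with
  | nil =>
      intro hu ha
      exact absurd ha hu
  | @cons x y z hadj p ih =>
      intro hx hz
      by_cases hy : y ∈ A
      · -- the first step already reaches a relay: r = y
        refine ⟨y, hy, ?_⟩
        have hmem : s(x, y) ∈ ω ∧ x ≠ y := (openGraph_adj ω x y).1 hadj
        have hadj' : (openGraph (ω ∩ {e | ∀ v, v ∈ e → v ∉ A ∨ v = y})).Adj x y := by
          rw [openGraph_adj]
          refine ⟨⟨hmem.1, ?_⟩, hmem.2⟩
          intro v hv
          rcases Sym2.mem_iff.1 hv with rfl | rfl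
          · exact Or.inl hx
          · exact Or.inr rfl
        exact hadj'.reachable
      · -- continue from the non-relay y
        obtain ⟨r, hr, hreach⟩ := ih hy hz
        refine ⟨r, hr, ?_⟩
        have hmem : s(x, y) ∈ ω ∧ x ≠ y := (openGraph_adj ω x y).1 hadj
        have hadj' : (openGraph (ω ∩ {e | ∀ v, v ∈ e → v ∉ A ∨ v = r})).Adj x y := by
          rw [openGraph_adj]
          refine ⟨⟨hmem.1, ?_⟩, hmem.2⟩
          intro v hv
          rcases Sym2.mem_iff.1 hv with rfl | rfl
          · exact Or.inl hx
          · exact Or.inl hy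
        exact hadj'.reachable.trans hreach

/-- **If the observer is joined to some relay, it has a frontier relay** (`{N ≥ 1} ⊆ {Γ* ≠ ∅}`; the converse inclusion is
`reachable_of_frontier`). [folklore] -/
theorem exists_frontier_of_reachable (A : Finset (Fin n)) {ω : BondConfig (Fin n)} {o a : Fin n}
    (ho : o ∉ A) (ha : a ∈ A) (h : (openGraph ω).Reachable o a) :
    ∃ r ∈ A, (openGraph (ω ∩ {e | ∀ v, v ∈ e → v ∉ A ∨ v = r})).Reachable o r := by
  obtain ⟨p⟩ := h
  exact exists_frontier_of_walk A ω p ho ha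

/-- **The bad event lives on the frontier**: if `1 ≤ N` (some relay is joined to `o`) then for some frontier relay `r` of `o`,
`|π(o)| = |π(r)|`; in particular `{1 ≤ N ≤ j} ⊆ ⋃_{r ∈ A} ({r frontier} ∩ {|π(r)| ≤ j})`. [folklore] -/
theorem bad_subset_frontier (A : Finset (Fin n)) (o : Fin n) (j : ℕ) (ho : o ∉ A) :
    {ω : BondConfig (Fin n) |
        1 ≤ (A.filter fun x => ω ∈ openConn o x).card ∧ (A.filter fun x => ω ∈ openConn o x).card ≤ j} ⊆
      ⋃ r ∈ A, ({ω : BondConfig (Fin n) | (openGraph (ω ∩ {e | ∀ v, v ∈ e → v ∉ A ∨ v = r})).Reachable o r} ∩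
        {ω | (A.filter fun x => ω ∈ openConn r x).card ≤ j}) := by
  intro ω hω
  simp only [Set.mem_setOf_eq] at hω
  obtain ⟨h1, hj⟩ := hω
  -- a relay joined to o
  obtain ⟨a, ha⟩ := Finset.card_pos.1 h1
  rw [Finset.mem_filter] at ha
  have hreach : (openGraph ω).Reachable o a := ha.2
  obtain ⟨r, hr, hfr⟩ := exists_frontier_of_reachable A ho ha.1 hreach
  simp only [Set.mem_iUnion, Set.mem_inter_iff, Set.mem_setOf_eq]
  refine ⟨r, hr, hfr, ?_⟩
  rw [← filter_eq_of_frontier A hfr]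
  exact hj

end FrontierTools

end Summit.CriticalPhenomena.PercolationContinuityZ3.Theorems

end
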